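import Summits.SmoothPoincare4.SmoothPoincare4.Theses.SymplecticOrigami
import Summits.SmoothPoincare4.SmoothPoincare4.Theses.SymplecticCap
import Summits.SmoothPoincare4.SmoothPoincare4.Theses.SullivanDual
import Summits.SmoothPoincare4.SmoothPoincare4.Theorems.SymplecticOrigamiGromovRecognitionRelEndStubEndDoesNotReturn
import Summits.SmoothPoincare4.SmoothPoincare4.Theorems.SymplecticOrigamiGromovRecognitionRelEndStubTameJ
import Summits.SmoothPoincare4.SmoothPoincare4.Theorems.SymplecticOrigamiGromovRecognitionRelEndStubCapModel
import Summits.SmoothPoincare4.SmoothPoincare4.Theorems.SymplecticOrigamiGromovRecognitionRelEndStubFlatCutoff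
import Summits.SmoothPoincare4.SmoothPoincare4.Theorems.SymplecticOrigamiGromovRecognitionRelEndStubTameMoser
import Summits.SmoothPoincare4.SmoothPoincare4.Theorems.SymplecticOrigamiGromovRecognitionRelEndStubWedgeDisjoint
import Summits.SmoothPoincare4.SmoothPoincare4.Theorems.SymplecticOrigamiGromovRecognitionRelEndStubSphereDetVanishes
import Summits.SmoothPoincare4.SmoothPoincare4.Theorems.SymplecticOrigamiGromovRecognitionRelEndStubFlatLeaves
import Summits.SmoothPoincare4.SmoothPoincare4.Theorems.SymplecticOrigamiGromovRecognitionRelEndStubReadSigma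
import Summits.SmoothPoincare4.SmoothPoincare4.Theorems.SymplecticOrigamiGromovRecognitionRelEndStubPositiveHolonomy
import Literature.Geometry.Symplectic.AlmostComplexStructure
import Literature.Geometry.Symplectic.GromovR4RelEnd

/-!
# Reduction of the crux `GromovRecognitionRelEnd` to its J-holomorphic CORE
(line `cross-cap-laurent`, item stmt-SmoothPoincare4-11009; continuation lead c1)

The crux — Gromov's recognition of `(ℝ⁴, ω₀)` relative at infinity, McDuff–Salamon 2017
Rem. 4.5.2 (viii) = `Literature.Geometry.Symplectic.gromov_recognitionR4_relEnd` = the three route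
copies `SymplecticCap.` / `SymplecticOrigami.` / `SullivanDual.GromovRecognitionRelEnd` (all `Iff.rfl`) —
follows from ONE statement, the registered stub `stub_biFoliationCore` of the line skeleton
`Cruxes/GromovRecognitionRelEnd/Lines/cross_cap_laurent.lean`: the chart-free existence of the two
`J`-holomorphic sphere fibrations of the capped manifold (Gromov 1985, 2.4.A₁′, p. 337: "S₁ as well as
S₂ includes into a family of rational J-curves which give a topological splitting V = S² × S² with
J-holomorphic fibers"; Wendl 2018, proof of Thm 6.8, pp. 138–139; McDuff–Salamon 2017 Rem. 4.5.2 (v)),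
packaged as two smooth retractions of the cap onto the spheres at infinity with `J`-invariant kernels,
jointly bijective, transversal.  EVERY OTHER STEP IS A THEOREM OF THE TREE:
`stub_endDoesNotReturn`, `stub_tameJ`, `stub_capModel`, `stub_flatCutoff`, `stub_tameMoser` (lead -0 and
workers) and `stub_wedgeDisjoint`, `stub_sphereDetVanishes`, `stub_flatLeaves`, `stub_readSigma`,
`stub_positiveHolonomy` (this lead's waves), files `Theorems/SymplecticOrigamiGromovRecognitionRelEndStub*.lean`.

This file records the reduction KERNEL-CHECKED and sorry-free, with NO definition: the hypothesis `hC`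
of `GromovRecognitionRelEnd_of_biFoliationCore` is VERBATIM the signature of `stub_biFoliationCore` AS
RE-REGISTERED by lead c1 on 2026-08-16 (skeleton `Lines/cross_cap_laurent.lean`, tree commit ed86e104e3ea;
`ledger skeleton check` of the integrated skeleton, one open stub) — the TRIMMED form: binders
`M, J, R₁, χ`, hypotheses `π₂(M) = 0` and `0 < R₁`, then the cap block, conclusion = 15 clauses.  Relative
to the form first registered by this lead (13:47Z, the one quoted in `Lines/cross-cap-laurent-core.md`
v1) it DROPS the end-chart binders `K, R, ψ`, the hypotheses H6–H9 (`ψ`, `χ` smooth, `Set.BijOn ψ Kᶜ …`,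
`χ (ψ x) = x`), `R < R₁` and `hJstd` (`J = ψ^*(i ⊕ i)` beyond `R₁`) — none of which occurs in the
conclusion; they only served to BUILD the cap in `stub_capModel` — and it DROPS the two positive-holonomy
clauses from the conclusion, which are now DERIVED (`stub_positiveHolonomy`, landed, called in the proof
below).  `hC` is thus stronger than the 13:47Z form as an implication (fewer hypotheses) and weaker in its
conclusion; it is the form a promoted item should carry.  The proof is the skeleton's composition with the
ten landed stubs inlined.
So the day the core is proved (or promoted, vendored as a named fact and discharged) the crux closes by
one application, for all three routes.  The core is NOT a restatement of the crux: its conclusion has no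
symplectic form, no `ψ`, no map to `ℝ⁴` — it is the pure holomorphic-curve content (the only consumer
of `π₂(M) = 0`).  It supersedes `…Reduction.lean` (`GromovRecognitionRelEnd_of_biFoliation`, lead -0),
whose hypothesis was the whole apex `stub_biFoliation` (now itself a theorem of the core and the four
soft stubs, see the skeleton).
-/

noncomputable section

-- the prescribed namespace `Summit.<P>.<Sub>.…` duplicates `SmoothPoincare4` (P = Sub)
set_option linter.dupNamespace false

open scoped Manifold ContDiff Topology
open Set TopologicalSpace Literature.Geometry.Kaehler Literature.Geometry.Symplectic

namespace Summit.SmoothPoincare4.SmoothPoincare4.Theorems.GromovRecognitionRelEnd.CrossCapLaurent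

/-- Model space `ℝ⁴ = ℂ²` (coordinates `0,1` = `z₁`, `2,3` = `z₂`). -/
local notation "E4" => EuclideanSpace ℝ (Fin 4)

/-- **The crux reduces to its J-holomorphic core.**  `hC` = the registered (trimmed, 2026-08-16, lead c1)
signature of `stub_biFoliationCore`: cap block + `π₂(M) = 0` + `0 < R₁` ⇒ the two retractions with 15
clauses (no end chart `ψ`, no `hJstd`, no holonomy clause — see the module docstring for the exact delta to
the first registration).  Composition of line `cross-cap-laurent` with the ten landed stubs inlined: Stub 1 (end does not return) → Stub 2 (tame `J`, integrable on a sub-end,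
`R₁ > max R 0`) → Stub 3 (wedge cap `X`) → CORE `hC` (the two retractions `lamV`, `lamH`; the only use of
`π₂(M) = 0`) → positive holonomy → wedge facts → flat leaves (with the analytic lemma) → the chart `σ` (split, tame, flat,
smooth at the wedge) → Stub 5 (decay + tame cut-off `Φ₁ = ψ` off a compact `K₁ ⊇ K`) → Stub 6
(compactly supported tame Moser) = the crux's conclusion.
[cite: Gromov1985, 2.4.A₁′–A₂′; McDuffSalamon2017, Rem. 4.5.2 (viii)] -/
theorem GromovRecognitionRelEnd_of_biFoliationCore
    (hC :
      ∀ (M : Type) [TopologicalSpace M] [T2Space M] [SecondCountableTopology M]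
        [ChartedSpace E4 M] [IsManifold (𝓡 4) ∞ M] [ConnectedSpace M]
        (J : AlmostComplexStructure (𝓡 4) ∞ M) (R₁ : ℝ) (χ : E4 → M),
        (∀ x : M, Subsingleton (π_ 2 M x)) →
        0 < R₁ →
        ∀ (X : Type) [TopologicalSpace X] [T2Space X] [SecondCountableTopology X] [CompactSpace X]
          [ConnectedSpace X] [ChartedSpace E4 X] [IsManifold (𝓡 4) ∞ X]
          (ωX : MForm (𝓡 4) X ℝ 2) (JX : AlmostComplexStructure (𝓡 4) ∞ X) (ι : M → X)
          (ηH ηV ηC : E4 → X),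
          (IsSmoothForm ωX ∧ IsClosedForm ωX ∧ JX.IsTamedBy ωX) ∧
          (IsLocalDiffeomorph (𝓡 4) (𝓡 4) ∞ ι ∧ Function.Injective ι ∧
            ∀ (x : M) (v : TangentSpace (𝓡 4) x),
              JX (ι x) (mfderiv (𝓡 4) (𝓡 4) ι x v) = mfderiv (𝓡 4) (𝓡 4) ι x (J x v)) ∧
          (IsLocalDiffeomorphOn 𝓘(ℝ, E4) (𝓡 4) ∞ ηV {p : E4 | p 0 ^ 2 + p 1 ^ 2 < R₁⁻¹ ^ 2} ∧
            Set.InjOn ηV {p : E4 | p 0 ^ 2 + p 1 ^ 2 < R₁⁻¹ ^ 2} ∧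
            (∀ p : E4, p 0 ^ 2 + p 1 ^ 2 < R₁⁻¹ ^ 2 → (p 0 ≠ 0 ∨ p 1 ≠ 0) →
              ηV p = ι (χ (WithLp.toLp 2
                ![p 0 / (p 0 ^ 2 + p 1 ^ 2), -(p 1) / (p 0 ^ 2 + p 1 ^ 2), p 2, p 3]))) ∧
            (∀ p : E4, p 0 = 0 → p 1 = 0 → ηV p ∉ Set.range ι) ∧
            (∀ p : E4, p 0 ^ 2 + p 1 ^ 2 < R₁⁻¹ ^ 2 → ∀ q : E4,
              JX (ηV p) (mfderiv 𝓘(ℝ, E4) (𝓡 4) ηV p q) =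
                mfderiv 𝓘(ℝ, E4) (𝓡 4) ηV p (WithLp.toLp 2 ![-(q 1), q 0, -(q 3), q 2]))) ∧
          (IsLocalDiffeomorphOn 𝓘(ℝ, E4) (𝓡 4) ∞ ηH {p : E4 | p 2 ^ 2 + p 3 ^ 2 < R₁⁻¹ ^ 2} ∧
            Set.InjOn ηH {p : E4 | p 2 ^ 2 + p 3 ^ 2 < R₁⁻¹ ^ 2} ∧
            (∀ p : E4, p 2 ^ 2 + p 3 ^ 2 < R₁⁻¹ ^ 2 → (p 2 ≠ 0 ∨ p 3 ≠ 0) →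
              ηH p = ι (χ (WithLp.toLp 2
                ![p 0, p 1, p 2 / (p 2 ^ 2 + p 3 ^ 2), -(p 3) / (p 2 ^ 2 + p 3 ^ 2)]))) ∧
            (∀ p : E4, p 2 = 0 → p 3 = 0 → ηH p ∉ Set.range ι) ∧
            (∀ p : E4, p 2 ^ 2 + p 3 ^ 2 < R₁⁻¹ ^ 2 → ∀ q : E4,
              JX (ηH p) (mfderiv 𝓘(ℝ, E4) (𝓡 4) ηH p q) =
                mfderiv 𝓘(ℝ, E4) (𝓡 4) ηH p (WithLp.toLp 2 ![-(q 1), q 0, -(q 3), q 2]))) ∧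
          (IsLocalDiffeomorphOn 𝓘(ℝ, E4) (𝓡 4) ∞ ηC
              {p : E4 | p 0 ^ 2 + p 1 ^ 2 < R₁⁻¹ ^ 2 ∧ p 2 ^ 2 + p 3 ^ 2 < R₁⁻¹ ^ 2} ∧
            Set.InjOn ηC {p : E4 | p 0 ^ 2 + p 1 ^ 2 < R₁⁻¹ ^ 2 ∧ p 2 ^ 2 + p 3 ^ 2 < R₁⁻¹ ^ 2} ∧
            (∀ p : E4, p 0 ^ 2 + p 1 ^ 2 < R₁⁻¹ ^ 2 → p 2 ^ 2 + p 3 ^ 2 < R₁⁻¹ ^ 2 →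
              (p 2 ≠ 0 ∨ p 3 ≠ 0) →
              ηC p = ηV (WithLp.toLp 2
                ![p 0, p 1, p 2 / (p 2 ^ 2 + p 3 ^ 2), -(p 3) / (p 2 ^ 2 + p 3 ^ 2)])) ∧
            (∀ p : E4, p 0 ^ 2 + p 1 ^ 2 < R₁⁻¹ ^ 2 → p 2 ^ 2 + p 3 ^ 2 < R₁⁻¹ ^ 2 →
              (p 0 ≠ 0 ∨ p 1 ≠ 0) →
              ηC p = ηH (WithLp.toLp 2
                ![p 0 / (p 0 ^ 2 + p 1 ^ 2), -(p 1) / (p 0 ^ 2 + p 1 ^ 2), p 2, p 3])) ∧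
            ηC 0 ∉ Set.range ι ∧
            (∀ p : E4, p 0 ^ 2 + p 1 ^ 2 < R₁⁻¹ ^ 2 → p 2 ^ 2 + p 3 ^ 2 < R₁⁻¹ ^ 2 → ∀ q : E4,
              JX (ηC p) (mfderiv 𝓘(ℝ, E4) (𝓡 4) ηC p q) =
                mfderiv 𝓘(ℝ, E4) (𝓡 4) ηC p (WithLp.toLp 2 ![-(q 1), q 0, -(q 3), q 2]))) ∧
          (∀ y : X, y ∈ Set.range ι ∨ (∃ p : E4, p 0 ^ 2 + p 1 ^ 2 < R₁⁻¹ ^ 2 ∧ ηV p = y) ∨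
            (∃ p : E4, p 2 ^ 2 + p 3 ^ 2 < R₁⁻¹ ^ 2 ∧ ηH p = y) ∨
            (∃ p : E4, (p 0 ^ 2 + p 1 ^ 2 < R₁⁻¹ ^ 2 ∧ p 2 ^ 2 + p 3 ^ 2 < R₁⁻¹ ^ 2) ∧ ηC p = y)) →
          ∃ lamV lamH : X → X,
            ContMDiff (𝓡 4) (𝓡 4) ∞ lamV ∧
            ContMDiff (𝓡 4) (𝓡 4) ∞ lamH ∧
            (∀ y : X, (∃ p : E4, p 2 = 0 ∧ p 3 = 0 ∧ ηH p = lamV y) ∨ lamV y = ηC 0) ∧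
            (∀ p : E4, p 2 = 0 → p 3 = 0 → lamV (ηH p) = ηH p) ∧
            lamV (ηC 0) = ηC 0 ∧
            (∀ y : X, (∃ q : E4, q 0 = 0 ∧ q 1 = 0 ∧ ηV q = lamH y) ∨ lamH y = ηC 0) ∧
            (∀ q : E4, q 0 = 0 → q 1 = 0 → lamH (ηV q) = ηV q) ∧
            lamH (ηC 0) = ηC 0 ∧
            (∀ y : X, lamV y = ηC 0 ↔ ((∃ q : E4, q 0 = 0 ∧ q 1 = 0 ∧ ηV q = y) ∨ y = ηC 0)) ∧
            (∀ y : X, lamH y = ηC 0 ↔ ((∃ p : E4, p 2 = 0 ∧ p 3 = 0 ∧ ηH p = y) ∨ y = ηC 0)) ∧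
            (∀ y y' : X, lamV y = lamV y' → lamH y = lamH y' → y = y') ∧
            (∀ p q : E4, p 2 = 0 → p 3 = 0 → q 0 = 0 → q 1 = 0 →
              ∃ y : X, lamV y = ηH p ∧ lamH y = ηV q) ∧
            (∀ (y : X) (v : TangentSpace (𝓡 4) y), mfderiv (𝓡 4) (𝓡 4) lamV y v = 0 →
              mfderiv (𝓡 4) (𝓡 4) lamV y (JX y v) = 0) ∧
            (∀ (y : X) (v : TangentSpace (𝓡 4) y), mfderiv (𝓡 4) (𝓡 4) lamH y v = 0 →
              mfderiv (𝓡 4) (𝓡 4) lamH y (JX y v) = 0) ∧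
            (∀ (y : X) (v : TangentSpace (𝓡 4) y), mfderiv (𝓡 4) (𝓡 4) lamV y v = 0 →
              mfderiv (𝓡 4) (𝓡 4) lamH y v = 0 → v = 0)) :
    Summit.SmoothPoincare4.SmoothPoincare4.Theses.SymplecticCap.GromovRecognitionRelEnd := by
  intro M _ _ _ _ _ _ sf K R ψ χ h1 h2 h3 h4 h5 h6 h7 h8 h9 h10
  -- Stub 1: the truncations are open
  have hopen : ∀ R', R < R' → IsOpen (K ∪ {x | x ∈ Kᶜ ∧ ‖ψ x‖ < R'}) :=
    stub_endDoesNotReturn M sf K R ψ χ h2 h5 h6 h7 h8 h9 h10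
  -- Stub 2: a tame `J`, integrable beyond `R₁`
  obtain ⟨R₁, J, hR₁, hR₁pos, hJt, hJstd⟩ := stub_tameJ M sf K R ψ h2 h4 h5 h6 h8 h10 hopen
  -- Stub 3: the wedge cap
  obtain ⟨X, _, _, _, _, _, _, _, ωX, JX, ι, ηH, ηV, ηC, hW⟩ :=
    stub_capModel M sf K R ψ χ h2 h3 h4 h5 h6 h7 h8 h9 h10 hopen R₁ J hR₁ hR₁pos hJt hJstd
  -- CORE: the two retractions
  obtain ⟨lamV, lamH, hsV, hsH, hinH, hrH, hrHc, hinV, hrV, hrVc, hcV, hcH, hinj, hsurj, hJV, hJH,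
      htr⟩ :=
    hC M J R₁ χ h1 hR₁pos X ωX JX ι ηH ηV ηC hW
  -- positivity of the holonomy (soft, landed)
  obtain ⟨hoV, hoH⟩ :=
    stub_positiveHolonomy M J K R R₁ ψ χ h6 h7 h8 h9 hR₁ hR₁pos hJstd X ωX JX ι ηH ηV ηC hW lamV lamH
      hsV hsH hinH hrH hrHc hinV hrV hrVc hcV hcH hJV hJH htr
  -- wedge facts
  obtain ⟨hwHV, hwH, hwV⟩ :=
    stub_wedgeDisjoint M J K R R₁ ψ χ h6 h7 h8 h9 hR₁ hR₁pos hJstd X ωX JX ι ηH ηV ηC hW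
  -- flat leaves (the analytic lemma fed in)
  obtain ⟨hfV, hfH⟩ :=
    stub_flatLeaves M J K R R₁ ψ χ h6 h7 h8 h9 hR₁ hR₁pos hJstd X ωX JX ι ηH ηV ηC hW lamV lamH
      hsV hsH hinH hrH hinV hrV hcV hcH hJV hJH hoV hoH stub_sphereDetVanishes
  -- the bi-foliation chart on `M`
  obtain ⟨σ, hB1, hB2, hB3a, hB3b, hB4, hB5⟩ :=
    stub_readSigma M J K R R₁ ψ χ h6 h7 h8 h9 hR₁ hR₁pos hJstd X ωX JX ι ηH ηV ηC hW lamV lamH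
      hsV hsH hinH hrH hrHc hinV hrV hrVc hcV hcH hinj hsurj hJV hJH htr hoV hoH hwHV hwH hwV hfV hfH
  -- Stub 5: decay + tame cut-off
  obtain ⟨Φ₁, K₁, hK₁, hKK₁, hΦψ, htame⟩ :=
    stub_flatCutoff M sf K R ψ χ h5 h6 h7 h8 h9 h10 R₁ J hR₁ hR₁pos hJt hJstd σ
      hB1 hB2 hB3a hB3b hB4 hB5
  -- Stub 6: compactly supported tame Moser
  exact stub_tameMoser M sf J K₁ ψ Φ₁ h2 h3 hK₁ hΦψ
    (fun x hx v w => h10 x (fun hxK => hx (hKK₁ hxK)) v w) hJt htame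

/-- The same reduction reaches the Literature named fact `gromov_recognitionR4_relEnd` (all three route
copies of the crux are this constant, `Iff.rfl`). [cite: McDuffSalamon2017, Rem. 4.5.2 (viii)] -/
theorem gromov_recognitionR4_relEnd_of_biFoliationCore
    (hC :
      ∀ (M : Type) [TopologicalSpace M] [T2Space M] [SecondCountableTopology M]
        [ChartedSpace E4 M] [IsManifold (𝓡 4) ∞ M] [ConnectedSpace M]
        (J : AlmostComplexStructure (𝓡 4) ∞ M) (R₁ : ℝ) (χ : E4 → M),
        (∀ x : M, Subsingleton (π_ 2 M x)) →
        0 < R₁ →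
        ∀ (X : Type) [TopologicalSpace X] [T2Space X] [SecondCountableTopology X] [CompactSpace X]
          [ConnectedSpace X] [ChartedSpace E4 X] [IsManifold (𝓡 4) ∞ X]
          (ωX : MForm (𝓡 4) X ℝ 2) (JX : AlmostComplexStructure (𝓡 4) ∞ X) (ι : M → X)
          (ηH ηV ηC : E4 → X),
          (IsSmoothForm ωX ∧ IsClosedForm ωX ∧ JX.IsTamedBy ωX) ∧
          (IsLocalDiffeomorph (𝓡 4) (𝓡 4) ∞ ι ∧ Function.Injective ι ∧
            ∀ (x : M) (v : TangentSpace (𝓡 4) x),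
              JX (ι x) (mfderiv (𝓡 4) (𝓡 4) ι x v) = mfderiv (𝓡 4) (𝓡 4) ι x (J x v)) ∧
          (IsLocalDiffeomorphOn 𝓘(ℝ, E4) (𝓡 4) ∞ ηV {p : E4 | p 0 ^ 2 + p 1 ^ 2 < R₁⁻¹ ^ 2} ∧
            Set.InjOn ηV {p : E4 | p 0 ^ 2 + p 1 ^ 2 < R₁⁻¹ ^ 2} ∧
            (∀ p : E4, p 0 ^ 2 + p 1 ^ 2 < R₁⁻¹ ^ 2 → (p 0 ≠ 0 ∨ p 1 ≠ 0) →
              ηV p = ι (χ (WithLp.toLp 2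
                ![p 0 / (p 0 ^ 2 + p 1 ^ 2), -(p 1) / (p 0 ^ 2 + p 1 ^ 2), p 2, p 3]))) ∧
            (∀ p : E4, p 0 = 0 → p 1 = 0 → ηV p ∉ Set.range ι) ∧
            (∀ p : E4, p 0 ^ 2 + p 1 ^ 2 < R₁⁻¹ ^ 2 → ∀ q : E4,
              JX (ηV p) (mfderiv 𝓘(ℝ, E4) (𝓡 4) ηV p q) =
                mfderiv 𝓘(ℝ, E4) (𝓡 4) ηV p (WithLp.toLp 2 ![-(q 1), q 0, -(q 3), q 2]))) ∧
          (IsLocalDiffeomorphOn 𝓘(ℝ, E4) (𝓡 4) ∞ ηH {p : E4 | p 2 ^ 2 + p 3 ^ 2 < R₁⁻¹ ^ 2} ∧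
            Set.InjOn ηH {p : E4 | p 2 ^ 2 + p 3 ^ 2 < R₁⁻¹ ^ 2} ∧
            (∀ p : E4, p 2 ^ 2 + p 3 ^ 2 < R₁⁻¹ ^ 2 → (p 2 ≠ 0 ∨ p 3 ≠ 0) →
              ηH p = ι (χ (WithLp.toLp 2
                ![p 0, p 1, p 2 / (p 2 ^ 2 + p 3 ^ 2), -(p 3) / (p 2 ^ 2 + p 3 ^ 2)]))) ∧
            (∀ p : E4, p 2 = 0 → p 3 = 0 → ηH p ∉ Set.range ι) ∧
            (∀ p : E4, p 2 ^ 2 + p 3 ^ 2 < R₁⁻¹ ^ 2 → ∀ q : E4,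
              JX (ηH p) (mfderiv 𝓘(ℝ, E4) (𝓡 4) ηH p q) =
                mfderiv 𝓘(ℝ, E4) (𝓡 4) ηH p (WithLp.toLp 2 ![-(q 1), q 0, -(q 3), q 2]))) ∧
          (IsLocalDiffeomorphOn 𝓘(ℝ, E4) (𝓡 4) ∞ ηC
              {p : E4 | p 0 ^ 2 + p 1 ^ 2 < R₁⁻¹ ^ 2 ∧ p 2 ^ 2 + p 3 ^ 2 < R₁⁻¹ ^ 2} ∧
            Set.InjOn ηC {p : E4 | p 0 ^ 2 + p 1 ^ 2 < R₁⁻¹ ^ 2 ∧ p 2 ^ 2 + p 3 ^ 2 < R₁⁻¹ ^ 2} ∧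
            (∀ p : E4, p 0 ^ 2 + p 1 ^ 2 < R₁⁻¹ ^ 2 → p 2 ^ 2 + p 3 ^ 2 < R₁⁻¹ ^ 2 →
              (p 2 ≠ 0 ∨ p 3 ≠ 0) →
              ηC p = ηV (WithLp.toLp 2
                ![p 0, p 1, p 2 / (p 2 ^ 2 + p 3 ^ 2), -(p 3) / (p 2 ^ 2 + p 3 ^ 2)])) ∧
            (∀ p : E4, p 0 ^ 2 + p 1 ^ 2 < R₁⁻¹ ^ 2 → p 2 ^ 2 + p 3 ^ 2 < R₁⁻¹ ^ 2 →
              (p 0 ≠ 0 ∨ p 1 ≠ 0) →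
              ηC p = ηH (WithLp.toLp 2
                ![p 0 / (p 0 ^ 2 + p 1 ^ 2), -(p 1) / (p 0 ^ 2 + p 1 ^ 2), p 2, p 3])) ∧
            ηC 0 ∉ Set.range ι ∧
            (∀ p : E4, p 0 ^ 2 + p 1 ^ 2 < R₁⁻¹ ^ 2 → p 2 ^ 2 + p 3 ^ 2 < R₁⁻¹ ^ 2 → ∀ q : E4,
              JX (ηC p) (mfderiv 𝓘(ℝ, E4) (𝓡 4) ηC p q) =
                mfderiv 𝓘(ℝ, E4) (𝓡 4) ηC p (WithLp.toLp 2 ![-(q 1), q 0, -(q 3), q 2]))) ∧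
          (∀ y : X, y ∈ Set.range ι ∨ (∃ p : E4, p 0 ^ 2 + p 1 ^ 2 < R₁⁻¹ ^ 2 ∧ ηV p = y) ∨
            (∃ p : E4, p 2 ^ 2 + p 3 ^ 2 < R₁⁻¹ ^ 2 ∧ ηH p = y) ∨
            (∃ p : E4, (p 0 ^ 2 + p 1 ^ 2 < R₁⁻¹ ^ 2 ∧ p 2 ^ 2 + p 3 ^ 2 < R₁⁻¹ ^ 2) ∧ ηC p = y)) →
          ∃ lamV lamH : X → X,
            ContMDiff (𝓡 4) (𝓡 4) ∞ lamV ∧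
            ContMDiff (𝓡 4) (𝓡 4) ∞ lamH ∧
            (∀ y : X, (∃ p : E4, p 2 = 0 ∧ p 3 = 0 ∧ ηH p = lamV y) ∨ lamV y = ηC 0) ∧
            (∀ p : E4, p 2 = 0 → p 3 = 0 → lamV (ηH p) = ηH p) ∧
            lamV (ηC 0) = ηC 0 ∧
            (∀ y : X, (∃ q : E4, q 0 = 0 ∧ q 1 = 0 ∧ ηV q = lamH y) ∨ lamH y = ηC 0) ∧
            (∀ q : E4, q 0 = 0 → q 1 = 0 → lamH (ηV q) = ηV q) ∧
            lamH (ηC 0) = ηC 0 ∧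
            (∀ y : X, lamV y = ηC 0 ↔ ((∃ q : E4, q 0 = 0 ∧ q 1 = 0 ∧ ηV q = y) ∨ y = ηC 0)) ∧
            (∀ y : X, lamH y = ηC 0 ↔ ((∃ p : E4, p 2 = 0 ∧ p 3 = 0 ∧ ηH p = y) ∨ y = ηC 0)) ∧
            (∀ y y' : X, lamV y = lamV y' → lamH y = lamH y' → y = y') ∧
            (∀ p q : E4, p 2 = 0 → p 3 = 0 → q 0 = 0 → q 1 = 0 →
              ∃ y : X, lamV y = ηH p ∧ lamH y = ηV q) ∧
            (∀ (y : X) (v : TangentSpace (𝓡 4) y), mfderiv (𝓡 4) (𝓡 4) lamV y v = 0 →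
              mfderiv (𝓡 4) (𝓡 4) lamV y (JX y v) = 0) ∧
            (∀ (y : X) (v : TangentSpace (𝓡 4) y), mfderiv (𝓡 4) (𝓡 4) lamH y v = 0 →
              mfderiv (𝓡 4) (𝓡 4) lamH y (JX y v) = 0) ∧
            (∀ (y : X) (v : TangentSpace (𝓡 4) y), mfderiv (𝓡 4) (𝓡 4) lamV y v = 0 →
              mfderiv (𝓡 4) (𝓡 4) lamH y v = 0 → v = 0)) :
    gromov_recognitionR4_relEnd :=
  GromovRecognitionRelEnd_of_biFoliationCore hC

/-- **Registered helper `helper_cruxSullivan_iff_literature`** (anchor of this file on item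
stmt-SmoothPoincare4-11009: the reduction theorems exceed the 4000-character limit of `workitem
stub-add`): the THIRD route copy of the crux, `SullivanDual.GromovRecognitionRelEnd` (route
`route-SmoothPoincare4-SullivanDual`, rank 5), is the audited Literature named fact as well,
definitionally — so `GromovRecognitionRelEnd_of_biFoliationCore` closes the crux for all three routes
wanting it. [cite: McDuffSalamon2017, Rem. 4.5.2 (viii)] -/
theorem helper_cruxSullivan_iff_literature :
    (Summit.SmoothPoincare4.SmoothPoincare4.Theses.SullivanDual.GromovRecognitionRelEnd ↔
      Literature.Geometry.Symplectic.gromov_recognitionR4_relEnd) :=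
  Iff.rfl

end Summit.SmoothPoincare4.SmoothPoincare4.Theorems.GromovRecognitionRelEnd.CrossCapLaurent

end
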